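import Literature.AlgebraicGeometry.Frobenioids.DivisorialDescriptionsHolds
import Literature.AlgebraicGeometry.Frobenioids.FrTrFromThm51i
import HarnessLib

/-!
# Frobenioids I, Theorem 5.1 (i)/(ii): the exact domain of validity of the named schemata
# `Thm51i_bijection F Ψ A`, `Thm51i_frobenius F Ψ A`, `Thm51ii_exists_iff F Ψ A A'` in `Ψ`

Mochizuki, *The geometry of Frobenioids I: the general theory*, Kyushu J. Math. **62** (2008)
293–400, §5, Theorem 5.1 (i), (ii), kurims text pp. 96–97 (statement), pp. 97–99 (proof)
[cite: MochizukiFrdI2008, Thm. 5.1 p.96].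

PROOF-ONLY companion of `DivisorialDescriptions.lean` (abc-iut-L1-t5), continuing
`DivisorialDescriptionsHolds.lean` (instance forms at the printed `Ψ := Φ^birat` by name; kernel `¬∀Ψ`
at `Ψ = 0` in the standard Frobenioid). Here the question "for WHICH subfunctors of groups
`Ψ ⊆ Φ^gp` does the typed statement hold?" is answered completely, for `C` a Frobenioid of isotropic
type and `A` (and `A'`) Frobenius-trivial (the standing hypotheses, which the named statements carry
as antecedents):

* `thm51i_bijection_iff_carrier_eq` — `Thm51i_bijection F Ψ A ↔ Ψ(A_D) = Φ^birat(A_D)`;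
* `thm51i_frobenius_iff_le` — `Thm51i_frobenius F Ψ A ↔ Φ^birat(A_D) ⊆ Ψ(A_D)`;
* `thm51ii_exists_iff_iff_carrier_eq` — `Thm51ii_exists_iff F Ψ A A' ↔ Ψ(A_D) = Φ^birat(A_D)` as
  soon as `D` has a morphism `A_D → A'_D` (without one the statement quantifies over no `θ` and holds
  for every `Ψ`: `thm51ii_exists_iff_of_isEmpty`); the implication `⇐` is unconditional
  (`thm51i_bijection_of_carrier_eq`, `thm51i_frobenius_of_le`, `thm51ii_exists_iff_of_carrier_eq`).

Mathematically this is the remark, implicit in the printed proof of (i) (pp. 98–99: the map from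
`A`-pairs to `Pic_C(A)` is surjective and two `A`-pairs give isomorphic objects over `A_D` iff their
classes differ by an element of `Φ^birat(A)`), that `Φ^birat(A) ⊆ Φ^gp(A)` IS the set of classes
`Φ(φ)⁻¹(Div(ψ) − Div(φ))` of the `A`-pairs `(φ, ψ)` whose object `(C, Base(φ) ∘ Base(ψ)⁻¹)` is
isomorphic in `C ×_D D^isom_{A_D}` to `(A, id)` — so `Pic_Φ(A) := Φ^gp(A)/Φ^birat(A)` (p. 96) is the ONLY
quotient of `Φ^gp(A)` for which (i) holds (`biratSubfunctor_carrier_eq_setOf_isIsomorphic`). Everything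
is derived from the landed `thm51i_holds` / `thm51ii_holds` / `thm51ii_exists_iff_of_thm51i` /
`exists_apair_cls_eq` (abc-iut-L1-t10 lineage) by quotient-group bookkeeping; no new definitions.
For the abc-iut FACT-LIST rows F-1060/F-1061/F-1062 this replaces «schema; instance forms» by one
closed characterisation each. [FrdI] is a refereed 2008 paper; nothing here bears on [IUTchIII].
-/

namespace Literature.AlgebraicGeometry.Frobenioids

open CategoryTheory Opposite

universe w v v' u u'

namespace PreFrobenioid

variable {D : Type u} [Category.{v} D] {Φ : Dᵒᵖ ⥤ CommMonCat.{w}}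
  {C : Type u'} [Category.{v'} C] (F : C ⥤ ElemFrobenioid Φ) (Ψ : GpSubfunctor Φ)

/-! ### Theorem 5.1 (i), bijection clause -/

/-- If `Ψ(A_D) = Φ^birat(A_D)` then the bijection clause of Thm. 5.1 (i) holds with `Φ^gp(A)/Ψ(A)` in
place of `Pic_Φ(A)` (it IS the printed statement up to the equality of subgroups).
[cite: MochizukiFrdI2008, Thm. 5.1 (i) p.96] -/
theorem thm51i_bijection_of_carrier_eq {A : C}
    (hΨ : Ψ.carrier (baseObj F A) = (biratSubfunctor F).carrier (baseObj F A)) :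
    Thm51i_bijection F Ψ A := by
  intro hF hiso hA
  obtain ⟨hbij, -, hsurjC⟩ := thm51i_bijection_holds F A hF hiso hA
  refine ⟨fun p q => ?_, fun γ => ?_, hsurjC⟩
  · rw [QuotientGroup.eq_iff_div_mem, hΨ, ← QuotientGroup.eq_iff_div_mem]
    exact hbij p q
  · obtain ⟨g, rfl⟩ := QuotientGroup.mk_surjective γ
    obtain ⟨p, hp⟩ := exists_apair_cls_eq F hF A g
    exact ⟨p, by rw [hp]⟩

/-- Conversely, if the bijection clause of Thm. 5.1 (i) holds for `Φ^gp(A)/Ψ(A)` (and `C` is a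
Frobenioid of isotropic type, `A` Frobenius-trivial), then `Ψ(A_D) = Φ^birat(A_D)`: both subgroups are
the set of classes of `A`-pairs isomorphic over `A_D` to the trivial pair, every element of `Φ^gp(A)`
being the class of an `A`-pair (p. 97). [cite: MochizukiFrdI2008, Thm. 5.1 (i) p.97] -/
theorem carrier_eq_of_thm51i_bijection {A : C} (hF : IsFrobenioid F) (hiso : IsOfIsotropicType F)
    (hA : IsFrobeniusTrivial F A) (h : Thm51i_bijection F Ψ A) :
    Ψ.carrier (baseObj F A) = (biratSubfunctor F).carrier (baseObj F A) := by
  obtain ⟨hbij, -, -⟩ := h hF hiso hA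
  obtain ⟨hbij', -, -⟩ := thm51i_bijection_holds F A hF hiso hA
  ext g
  obtain ⟨p, hp⟩ := exists_apair_cls_eq F hF A g
  have h1 : g ∈ Ψ.carrier (baseObj F A) ↔
      (⟦p.toIsomOver⟧ : PicC F (baseObj F A)) = ⟦(APair.trivial F A).toIsomOver⟧ := by
    rw [← hbij p, QuotientGroup.eq_iff_div_mem, hp, APair.cls_trivial, div_one]
  have h2 : g ∈ (biratSubfunctor F).carrier (baseObj F A) ↔
      (⟦p.toIsomOver⟧ : PicC F (baseObj F A)) = ⟦(APair.trivial F A).toIsomOver⟧ := by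
    rw [← hbij' p, QuotientGroup.eq_iff_div_mem, hp, APair.cls_trivial, div_one]
  exact h1.trans h2.symm

/-- **Domain of validity of the schema `Thm51i_bijection F Ψ A`** (FACT-LIST F-1060): for `C` a
Frobenioid of isotropic type and `A` Frobenius-trivial, the bijection clause of Thm. 5.1 (i) holds for
`Φ^gp(A)/Ψ(A)` if and only if `Ψ(A_D) = Φ^birat(A_D)` — `Pic_Φ(A) := Φ^gp(A)/Φ^birat(A)` (p. 96) is the
unique quotient for which (i) holds. [cite: MochizukiFrdI2008, Thm. 5.1 (i) p.96] -/
theorem thm51i_bijection_iff_carrier_eq {A : C} (hF : IsFrobenioid F) (hiso : IsOfIsotropicType F)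
    (hA : IsFrobeniusTrivial F A) :
    Thm51i_bijection F Ψ A ↔ Ψ.carrier (baseObj F A) = (biratSubfunctor F).carrier (baseObj F A) :=
  ⟨carrier_eq_of_thm51i_bijection F Ψ hF hiso hA, thm51i_bijection_of_carrier_eq F Ψ⟩

/-- `Φ^birat(A)` is exactly the set of classes `Φ(φ)⁻¹(Div(ψ) − Div(φ))` of the `A`-pairs `(φ, ψ)` whose
object `(C, Base(φ) ∘ Base(ψ)⁻¹)` is isomorphic in `C ×_D D^isom_{A_D}` to `(A, id)` (the kernel of the
surjection `Φ^gp(A) → Pic_C(A)` of the proof of Thm. 5.1 (i), pp. 98–99).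
[cite: MochizukiFrdI2008, Thm. 5.1 (i) p.98] -/
theorem biratSubfunctor_carrier_eq_setOf_isIsomorphic {A : C} (hF : IsFrobenioid F)
    (hiso : IsOfIsotropicType F) (hA : IsFrobeniusTrivial F A) :
    ((biratSubfunctor F).carrier (baseObj F A) : Set (Algebra.GrothendieckGroup (Φ.obj (op (baseObj F A))))) =
      {g | ∃ p : APair F A, p.cls = g ∧
        (⟦p.toIsomOver⟧ : PicC F (baseObj F A)) = ⟦(APair.trivial F A).toIsomOver⟧} := by
  obtain ⟨hbij, -, -⟩ := thm51i_bijection_holds F A hF hiso hA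
  ext g
  constructor
  · intro hg
    obtain ⟨p, hp⟩ := exists_apair_cls_eq F hF A g
    refine ⟨p, hp, (hbij p (APair.trivial F A)).mp ?_⟩
    rw [QuotientGroup.eq_iff_div_mem, hp, APair.cls_trivial, div_one]
    exact hg
  · rintro ⟨p, hp, hiso'⟩
    have h := (hbij p (APair.trivial F A)).mpr hiso'
    rw [QuotientGroup.eq_iff_div_mem, hp, APair.cls_trivial, div_one] at h
    exact h

/-! ### Theorem 5.1 (i), "Moreover" (morphisms of Frobenius type) -/

/-- If `Φ^birat(A_D) ⊆ Ψ(A_D)` then the "Moreover" clause of Thm. 5.1 (i) holds in `Φ^gp(A)/Ψ(A)` (image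
of the printed statement under `Φ^gp(A)/Φ^birat(A) ↠ Φ^gp(A)/Ψ(A)`).
[cite: MochizukiFrdI2008, Thm. 5.1 (i) p.96] -/
theorem thm51i_frobenius_of_le {A : C}
    (hle : (biratSubfunctor F).carrier (baseObj F A) ≤ Ψ.carrier (baseObj F A)) :
    Thm51i_frobenius F Ψ A := by
  intro hF hiso hA X C' κ hκ p p' hp hp'
  have h := thm51i_frobenius_holds F A hF hiso hA X κ hκ p p' hp hp'
  rw [← QuotientGroup.mk_pow, QuotientGroup.eq_iff_div_mem] at h ⊢
  exact hle h

/-- Conversely, if the "Moreover" clause of Thm. 5.1 (i) holds in `Φ^gp(A)/Ψ(A)` (for `C` a Frobenioid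
of isotropic type, `A` Frobenius-trivial) then `Φ^birat(A_D) ⊆ Ψ(A_D)`: apply it to the morphism of
Frobenius type `κ = id_A` and to an `A`-pair `p` with class `b ∈ Φ^birat(A_D)`, which represents the
same object of `C ×_D D^isom_{A_D}` as the trivial pair by (i). [cite: MochizukiFrdI2008, Thm. 5.1 (i) p.96] -/
theorem le_of_thm51i_frobenius {A : C} (hF : IsFrobenioid F) (hiso : IsOfIsotropicType F)
    (hA : IsFrobeniusTrivial F A) (h : Thm51i_frobenius F Ψ A) :
    (biratSubfunctor F).carrier (baseObj F A) ≤ Ψ.carrier (baseObj F A) := by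
  intro b hb
  obtain ⟨hbij, -, -⟩ := thm51i_bijection_holds F A hF hiso hA
  obtain ⟨p, hp⟩ := exists_apair_cls_eq F hF A b
  set p₀ := APair.trivial F A with hp₀
  have hC : (⟦p.toIsomOver⟧ : PicC F (baseObj F A)) = ⟦p₀.toIsomOver⟧ := by
    refine (hbij p p₀).mp ?_
    rw [QuotientGroup.eq_iff_div_mem, hp, APair.cls_trivial, div_one]
    exact hb
  have hid : IsFrobeniusType F (𝟙 p₀.toIsomOver.obj) :=
    isFrobeniusType_of_isIso F hF.isPreFrobenioid _
  have hpush : (⟦p.toIsomOver⟧ : PicC F (baseObj F A)) = ⟦p₀.toIsomOver.pushforward (𝟙 _) hid.2⟧ := by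
    refine hC.trans (Quotient.sound ⟨Iso.refl _, ?_⟩)
    show Base F (𝟙 _) ≫ (IsomOver.pushforward p₀.toIsomOver (𝟙 _) hid.2).iso.hom = p₀.toIsomOver.iso.hom
    simp [IsomOver.pushforward]
  have key := h hF hiso hA p₀.toIsomOver (𝟙 _) hid p₀ p rfl hpush
  rw [APair.cls_trivial, QuotientGroup.mk_one, one_pow, QuotientGroup.eq_one_iff, hp] at key
  exact key

/-- **Domain of validity of the schema `Thm51i_frobenius F Ψ A`** (FACT-LIST F-1061): for `C` a
Frobenioid of isotropic type and `A` Frobenius-trivial, the "Moreover" clause of Thm. 5.1 (i) holds in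
`Φ^gp(A)/Ψ(A)` if and only if `Φ^birat(A_D) ⊆ Ψ(A_D)`. [cite: MochizukiFrdI2008, Thm. 5.1 (i) p.96] -/
theorem thm51i_frobenius_iff_le {A : C} (hF : IsFrobenioid F) (hiso : IsOfIsotropicType F)
    (hA : IsFrobeniusTrivial F A) :
    Thm51i_frobenius F Ψ A ↔ (biratSubfunctor F).carrier (baseObj F A) ≤ Ψ.carrier (baseObj F A) :=
  ⟨le_of_thm51i_frobenius F Ψ hF hiso hA, thm51i_frobenius_of_le F Ψ⟩

/-! ### Theorem 5.1 (ii) -/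

/-- If `Ψ(A_D) = Φ^birat(A_D)` then the existence criterion of Thm. 5.1 (ii) holds with `Φ^gp(A)/Ψ(A)`
in place of `Pic_Φ(A)` (via the landed derivation of (ii) from (i) for a general `Ψ`).
[cite: MochizukiFrdI2008, Thm. 5.1 (ii) p.97] -/
theorem thm51ii_exists_iff_of_carrier_eq {A A' : C}
    (hΨ : Ψ.carrier (baseObj F A) = (biratSubfunctor F).carrier (baseObj F A)) :
    Thm51ii_exists_iff F Ψ A A' :=
  thm51ii_exists_iff_of_thm51i Ψ (thm51i_bijection_of_carrier_eq F Ψ hΨ)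
    (thm51i_frobenius_of_le F Ψ hΨ.ge)

/-- If `D` has no morphism `A_D → A'_D`, the typed Thm. 5.1 (ii) quantifies over no `θ` and holds for
every `Ψ`. [cite: MochizukiFrdI2008, Thm. 5.1 (ii) p.97] -/
theorem thm51ii_exists_iff_of_isEmpty {A A' : C} (hθ : IsEmpty (baseObj F A ⟶ baseObj F A')) :
    Thm51ii_exists_iff F Ψ A A' :=
  fun _ _ _ _ _ _ _ _ _ _ _ θ => (hθ.false θ).elim

/-- Conversely, if the existence criterion of Thm. 5.1 (ii) holds with `Φ^gp(A)/Ψ(A)` in place of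
`Pic_Φ(A)` (for `C` a Frobenioid of isotropic type, `A, A'` Frobenius-trivial) and `D` has a morphism
`θ₀ : A_D → A'_D`, then `Ψ(A_D) = Φ^birat(A_D)`: compare, for `d = 1`, `θ = θ₀`, `z = 0`, `(B, λ)` the
object of an `A`-pair `p` with prescribed class and `(B', λ')` that of the trivial `A'`-pair, the typed
criterion with the printed one (`thm51ii_holds`): both reduce to "class of `p` ∈ `Ψ(A_D)`", resp.
"`∈ Φ^birat(A_D)`". [cite: MochizukiFrdI2008, Thm. 5.1 (ii) p.97] -/
theorem carrier_eq_of_thm51ii_exists_iff {A A' : C} (hF : IsFrobenioid F) (hiso : IsOfIsotropicType F)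
    (hA : IsFrobeniusTrivial F A) (hA' : IsFrobeniusTrivial F A') (θ₀ : baseObj F A ⟶ baseObj F A')
    (h : Thm51ii_exists_iff F Ψ A A') :
    Ψ.carrier (baseObj F A) = (biratSubfunctor F).carrier (baseObj F A) := by
  ext g
  obtain ⟨p, hp⟩ := exists_apair_cls_eq F hF A g
  set p₀' := APair.trivial F A' with hp₀'
  -- the two criteria at `X = (p)`, `X' = (p₀')`, `d = 1`, `θ = θ₀`, `z = 0`
  have e : ∀ Ψ' : GpSubfunctor Φ,
      ((QuotientGroup.mk p.cls : Ψ'.Pic (baseObj F A)) ^ ((1 : ℕ+) : ℕ) *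
          QuotientGroup.mk (Algebra.GrothendieckGroup.of (pull Φ p.toIsomOver.iso.inv 1)) =
        Ψ'.picPull θ₀ (QuotientGroup.mk p₀'.cls)) ↔ g ∈ Ψ'.carrier (baseObj F A) := by
    intro Ψ'
    rw [APair.cls_trivial, QuotientGroup.mk_one, MonoidHom.map_one, MonoidHom.map_one,
      MonoidHom.map_one, QuotientGroup.mk_one, mul_one, PNat.one_coe, pow_one, QuotientGroup.eq_one_iff, hp]
  have h1 := h hF hiso hA hA' p.toIsomOver p₀'.toIsomOver p p₀' rfl rfl 1 θ₀ 1
  have h2 := thm51ii_exists_iff_holds F A A' hF hiso hA hA' p.toIsomOver p₀'.toIsomOver p p₀' rfl rfl 1 θ₀ 1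
  rw [e] at h1 h2
  exact h1.symm.trans h2

/-- **Domain of validity of the schema `Thm51ii_exists_iff F Ψ A A'`** (FACT-LIST F-1062): for `C` a
Frobenioid of isotropic type, `A, A'` Frobenius-trivial and `D` having a morphism `A_D → A'_D`, the
existence criterion of Thm. 5.1 (ii) holds with `Φ^gp(A)/Ψ(A)` in place of `Pic_Φ(A)` if and only if
`Ψ(A_D) = Φ^birat(A_D)`. [cite: MochizukiFrdI2008, Thm. 5.1 (ii) p.97] -/
theorem thm51ii_exists_iff_iff_carrier_eq {A A' : C} (hF : IsFrobenioid F) (hiso : IsOfIsotropicType F)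
    (hA : IsFrobeniusTrivial F A) (hA' : IsFrobeniusTrivial F A')
    (hθ : Nonempty (baseObj F A ⟶ baseObj F A')) :
    Thm51ii_exists_iff F Ψ A A' ↔ Ψ.carrier (baseObj F A) = (biratSubfunctor F).carrier (baseObj F A) :=
  ⟨fun h => carrier_eq_of_thm51ii_exists_iff F Ψ hF hiso hA hA' hθ.some h,
    thm51ii_exists_iff_of_carrier_eq F Ψ⟩

/-- In particular (same object twice, `θ₀ = id`): `Thm51ii_exists_iff F Ψ A A ↔ Ψ(A_D) = Φ^birat(A_D)`.
[cite: MochizukiFrdI2008, Thm. 5.1 (ii) p.97] -/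
theorem thm51ii_exists_iff_self_iff_carrier_eq {A : C} (hF : IsFrobenioid F)
    (hiso : IsOfIsotropicType F) (hA : IsFrobeniusTrivial F A) :
    Thm51ii_exists_iff F Ψ A A ↔ Ψ.carrier (baseObj F A) = (biratSubfunctor F).carrier (baseObj F A) :=
  thm51ii_exists_iff_iff_carrier_eq F Ψ hF hiso hA hA ⟨𝟙 _⟩

end PreFrobenioid

end Literature.AlgebraicGeometry.Frobenioids
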